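import Summits.AnomalousDissipation.AnomalousDissipation.Theses.TaylorCertificates
import Summits.AnomalousDissipation.AnomalousDissipation.Theorems.TaylorCertificatePair.Negative.Modes
import Literature.Analysis.FunctionSpaces.TorusFluidGlueProofs
import Literature.Analysis.FunctionSpaces.TorusLerayHelmholtzProofs
import Literature.Analysis.FunctionSpaces.TorusCalculusProofs
import Literature.Analysis.FunctionSpaces.TorusTestFunction
import Literature.Analysis.FluidPDE.OnsagerBDSVGluing
import Literature.Analysis.FluidPDE.BiotSavartIdentities
import Literature.Analysis.FluidPDE.BeltramiWavesCurl

/-!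
# Stub `stub_vorticityTransport` of the line `Sketch` (helical path) for the crux
# `TaylorCertificates.SmoothEulerCoerciveForce` (stmt-AnomalousDissipation-14097)

The steady vorticity equation for the helical Kolmogorov force on the flat torus `T³`.
Let `b = (sin 2πx₃, cos 2πx₃, 0)`, written inline as the real Fourier mode
`Torus.realTrigPoly {![0,0,1]} (fun _ => WithLp.toLp 2 ![-I, 1, 0])`.  If `v` is smooth and
divergence free, `p` is smooth and `(v·∇)v + ∇p = b` pointwise, then the vorticity `ω = curl v`
(the tree's `BDSV.curl`) satisfies

  `(v·∇)ω − (ω·∇)v = 2π b`.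

Proof (Majda–Bertozzi, *Vorticity and incompressible flow*, §1.2 / §2.4.1): take `curl` of the
momentum equation (`BDSV.curl_add`); the pressure drops out (`BDSV.curl_gradient`, Schwarz);
`curl((v·∇)v) = (v·∇)ω + T` with the stretching vector `T` of `BDSV.curl_convect`, and
`T = −(ω·∇)v` because `div v = 0` (`vorticityTransport_stretching`, a polynomial identity in the
nine first derivatives `∂ⱼvᵢ`); finally `b` is a `+2π` Beltrami mode, `curl b = 2π b`
(`vorticityTransport_curl_helical`, from `IntermittentBeltrami.curl_realTrigPoly` and the cross
product `(0,0,1) × (−i,1,0) = (−1,−i,0) = −i(−i,1,0)`). [folklore]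

Not here: the work identity, the strong form with pressure, the Bernoulli-head transport, the Lamb
form (the other stubs of the line), the helical core, and the composition into the crux.
-/

-- `Summit.<Summit>.<Problem>` is the tree's mandated summit-side namespace (CONVENTIONS §2); for this
-- single-conjunct summit the two coincide, so the duplicate is deliberate.
set_option linter.dupNamespace false

noncomputable section

open MeasureTheory
open scoped InnerProductSpace

namespace Summit.AnomalousDissipation.AnomalousDissipation.Theorems.SmoothEulerCoerciveForce.Helical

open Literature.Analysis.FunctionSpaces
open Summit.AnomalousDissipation.AnomalousDissipation.Theses.TaylorCertificates
open Summit.AnomalousDissipation.AnomalousDissipation.Theorems.TaylorCertificatePair.Negative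
open Literature.Analysis.FluidPDE

/-- **Vortex stretching for a divergence-free field.** For smooth divergence-free `v` on `T³` the
extra vector `T` of `BDSV.curl_convect` (with `u = Z = v`),
`T₀ = ((∂₁v·∇)v)₂ − ((∂₂v·∇)v)₁` and cyclically, equals `−(ω·∇)v` with `ω = curl v`:
componentwise `∑ⱼ (∂₁vⱼ ∂ⱼv₂ − ∂₂vⱼ ∂ⱼv₁) = −∑ⱼ ωⱼ ∂ⱼv₀ + ω₀ div v` and `div v = 0`
(Majda–Bertozzi §1.2, the vorticity-stretching term). [folklore] -/
theorem vorticityTransport_stretching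
    {v : UnitAddTorus (Fin 3) → EuclideanSpace ℝ (Fin 3)} (hvs : Torus.IsSmooth v)
    (hvd : Torus.IsDivFree v) (x : UnitAddTorus (Fin 3)) :
    (WithLp.toLp 2 ![Torus.convect (Torus.partialDeriv 1 v) v x 2 - Torus.convect (Torus.partialDeriv 2 v) v x 1,
        Torus.convect (Torus.partialDeriv 2 v) v x 0 - Torus.convect (Torus.partialDeriv 0 v) v x 2,
        Torus.convect (Torus.partialDeriv 0 v) v x 1 - Torus.convect (Torus.partialDeriv 1 v) v x 0] :
      EuclideanSpace ℝ (Fin 3)) = -Torus.convect (BDSV.curl v) v x := by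
  have hv1 : Torus.IsContDiff 1 v := hvs.isContDiff (by simp)
  -- `((∂_b v·∇)v)_c = ∑ⱼ ∂_b vⱼ ∂ⱼ v_c`
  have hT : ∀ b c : Fin 3, Torus.convect (Torus.partialDeriv b v) v x c =
      ∑ j : Fin 3, Torus.partialDeriv b v x j * Torus.partialDeriv j v x c := fun b c =>
    BDSV.convect_apply_coord_sum hv1 x c
  -- `((ω·∇)v)_c = ∑ⱼ ωⱼ ∂ⱼ v_c`
  have hW : ∀ c : Fin 3, Torus.convect (BDSV.curl v) v x c =
      ∑ j : Fin 3, BDSV.curl v x j * Torus.partialDeriv j v x c := fun c =>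
    BDSV.convect_apply_coord_sum hv1 x c
  -- `div v = ∑ᵢ ∂ᵢvᵢ = 0`
  have hdiv : ∑ i : Fin 3, Torus.partialDeriv i v x i = 0 := by
    rw [← Torus.divergence_eq_sum_partialDeriv_apply hv1 x]
    exact hvd x
  simp only [Fin.sum_univ_three] at hT hW hdiv
  ext c
  fin_cases c
  · simp only [Fin.zero_eta, PiLp.neg_apply, Matrix.cons_val_zero]
    rw [hW 0, BDSV.curl_apply_zero, BDSV.curl_apply_one, BDSV.curl_apply_two, hT 1 2, hT 2 1]
    linear_combination (Torus.partialDeriv 1 v x 2 - Torus.partialDeriv 2 v x 1) * hdiv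
  · simp only [Fin.mk_one, PiLp.neg_apply, Matrix.cons_val_one, Matrix.cons_val_zero]
    rw [hW 1, BDSV.curl_apply_zero, BDSV.curl_apply_one, BDSV.curl_apply_two, hT 2 0, hT 0 2]
    linear_combination (Torus.partialDeriv 2 v x 0 - Torus.partialDeriv 0 v x 2) * hdiv
  · simp only [Fin.reduceFinMk, PiLp.neg_apply, Matrix.cons_val]
    rw [hW 2, BDSV.curl_apply_zero, BDSV.curl_apply_one, BDSV.curl_apply_two, hT 0 1, hT 1 0]
    linear_combination (Torus.partialDeriv 0 v x 1 - Torus.partialDeriv 1 v x 0) * hdiv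

/-- **`curl((v·∇)v) = (v·∇)ω − (ω·∇)v`** for smooth divergence-free `v` on `T³`, `ω = curl v`
(`BDSV.curl_convect` and `vorticityTransport_stretching`; Majda–Bertozzi §1.2). [folklore] -/
theorem vorticityTransport_curl_convect_self
    {v : UnitAddTorus (Fin 3) → EuclideanSpace ℝ (Fin 3)} (hvs : Torus.IsSmooth v)
    (hvd : Torus.IsDivFree v) (x : UnitAddTorus (Fin 3)) :
    BDSV.curl (Torus.convect v v) x =
      Torus.convect v (BDSV.curl v) x - Torus.convect (BDSV.curl v) v x := by
  rw [BDSV.curl_convect hvs hvs x, vorticityTransport_stretching hvs hvd x, sub_eq_add_neg]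

/-- **The helical force is a `+2π` Beltrami mode**: for `b = Re(e_{(0,0,1)} (−i,1,0)) =
(sin 2πx₃, cos 2πx₃, 0)` one has `curl b = 2π b` (`IntermittentBeltrami.curl_realTrigPoly`:
the curl coefficient is `2πi (0,0,1) × (−i,1,0) = 2πi (−1,−i,0) = 2π (−i,1,0)`). [folklore] -/
theorem vorticityTransport_curl_helical (x : UnitAddTorus (Fin 3)) :
    BDSV.curl (Torus.realTrigPoly {![0, 0, 1]} (fun _ => WithLp.toLp 2 ![-Complex.I, 1, 0])) x =
      (2 * Real.pi) • Torus.realTrigPoly {![0, 0, 1]} (fun _ => WithLp.toLp 2 ![-Complex.I, 1, 0]) x := by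
  have hcoef : ∀ k ∈ ({![0, 0, 1]} : Finset (Fin 3 → ℤ)),
      IntermittentBeltrami.curlCoeff (fun _ => WithLp.toLp 2 ![-Complex.I, 1, 0]) k =
        ((2 * Real.pi : ℝ) : ℂ) • (fun _ : Fin 3 → ℤ => (WithLp.toLp 2 ![-Complex.I, 1, 0] :
          EuclideanSpace ℂ (Fin 3))) k := by
    intro k hk
    rw [Finset.mem_singleton] at hk
    subst hk
    ext i
    rw [IntermittentBeltrami.curlCoeff_apply, PiLp.smul_apply, smul_eq_mul]
    fin_cases i <;> simp [cross_apply, Complex.ext_iff]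
  rw [IntermittentBeltrami.curl_realTrigPoly, Torus.realTrigPoly_congr hcoef,
    IntermittentBeltrami.realTrigPoly_ofReal_smul]

/-- **Stub 5 (steady vorticity equation for the helical force).** If `v` is smooth and divergence
free on `T³` and `(v·∇)v + ∇p = b` pointwise with `p` smooth and
`b = (sin 2πx₃, cos 2πx₃, 0) = Torus.realTrigPoly {![0,0,1]} (fun _ => WithLp.toLp 2 ![-I, 1, 0])`,
then `ω := curl v` obeys `(v·∇)ω − (ω·∇)v = curl b = 2π b`: the curl of the momentum equation
(`curl ∇p = 0`, `curl((v·∇)v) = (v·∇)ω − (ω·∇)v` for `div v = 0`, `curl b = 2π b`;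
Majda–Bertozzi §1.2 / §2.4.1). [folklore] -/
theorem stub_vorticityTransport
    (v : UnitAddTorus (Fin 3) → EuclideanSpace ℝ (Fin 3)) (p : UnitAddTorus (Fin 3) → ℝ)
    (hvs : Torus.IsSmooth v) (hvd : Torus.IsDivFree v) (hp : Torus.IsSmooth p)
    (he : ∀ x, Torus.convect v v x + Torus.gradient p x =
      Torus.realTrigPoly {![0, 0, 1]} (fun _ => WithLp.toLp 2 ![-Complex.I, 1, 0]) x) :
    ∀ x, Torus.convect v (Literature.Analysis.FluidPDE.BDSV.curl v) x -
        Torus.convect (Literature.Analysis.FluidPDE.BDSV.curl v) v x =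
      (2 * Real.pi) • Torus.realTrigPoly {![0, 0, 1]} (fun _ => WithLp.toLp 2 ![-Complex.I, 1, 0]) x := by
  intro x
  have hcv : Torus.IsContDiff 1 (Torus.convect v v) := (hvs.convect hvs).isContDiff (by simp)
  have hgp : Torus.IsContDiff 1 (Torus.gradient p) := hp.gradient.isContDiff (by simp)
  -- the momentum equation as an identity of fields
  have hfun : Torus.convect v v + Torus.gradient p =
      Torus.realTrigPoly {![0, 0, 1]} (fun _ => WithLp.toLp 2 ![-Complex.I, 1, 0]) := funext he
  -- take `curl`: the pressure drops out, the force is a `+2π` Beltrami mode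
  have hcurl : BDSV.curl (Torus.convect v v) x =
      (2 * Real.pi) • Torus.realTrigPoly {![0, 0, 1]} (fun _ => WithLp.toLp 2 ![-Complex.I, 1, 0]) x := by
    rw [← vorticityTransport_curl_helical x, ← hfun, BDSV.curl_add hcv hgp x, BDSV.curl_gradient hp x,
      add_zero]
  rw [← vorticityTransport_curl_convect_self hvs hvd x, hcurl]

end Summit.AnomalousDissipation.AnomalousDissipation.Theorems.SmoothEulerCoerciveForce.Helical

end
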